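import Summits.CriticalPhenomena.PercolationContinuityZ3.Theorems.Transplant.SnowballSqueezeTowerLemmas
import Mathlib.Analysis.Complex.ExponentialBounds
import HarnessLib

/-!
# The snowball squeeze, STEP 2 part (b2): THE TOWER — `NearCriticalShortLRO` on every connected vertex-transitive graph carrying the snowballing
# implication `SnowballStep G d`, stretched-exponential growth `GrowthLower(a)`, and `1/d < p_c < 1` (generic; kernel; no named fact inside)

Proof file (`--supports stmt-CriticalPhenomena-4575`), lane `prim-bschramm`, seat `prim-bschramm-gen-1` gen 11 (GEN pen), lead g28's conditional GO #9067 / #9090 for N1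
STEP 2 (w-idea-2 g5 CARD-5 «sprinkled-ghost-squeeze»; memo SUPPLEMENT-N1-typing-memo.md §3 S0–S4, in the PRESCRIBED-SCHEDULE form of the pen's design note,
lead bus 2026-08-29 «Simplification A»).  builds on p205010 (kernel theorem, internal audit signed; external expert review pending) — nothing in this file uses
p205010.  Def-free; no instance, no notation, no sorry, no `@[conjecture]`, default heartbeats.  NO named fact is used: the snowballing implication is the HYPOTHESIS
`SnowballStep G d` (for the two Grigorchuk witnesses it is supplied, CONDITIONALLY on Easo–Hutchcroft's printed Prop. 4.1 (15), by «GrigorchukWitnessSnowballStep»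
— that instantiation is STEP 2 (c), not this file).  Nothing about `θ(p_c)`.

THE THEOREM `nearCriticalShortLRO_of_snowballStep`: for `G` connected, vertex-transitive, locally finite, `SnowballStep G d` (`d ≥ 1`), `GrowthLower G o a` (`a > 0`),
`1/d < p_c(o) < 1`, and every `c > 0`: **`NearCriticalShortLRO G o a 4 c`** — there are `C, m₀` with `κ_p(3m) < m^{−c}` for all `m ≥ m₀` and all
`p ≤ p_c − C((log m + 1)/m^a)^{1/4}`.
PROOF (by contradiction from a floor `F₀ = m^{−c} ≤ κ_p(3m)`; WLOG `p ≥ 1/d` by monotonicity in `p`):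
* scales `m_0 = m < m_1 < …` with `log|B(o, m_{k+1})| ≥ 64·log|B(o, m_k)|` and `m_{k+1} ≤ m_k + N_G + (64 log|B(o,m_k)|/c_G)^{1/a} + 2` («Scales» `exists_scale`);
* sprinkles PRESCRIBED: `δ_k = δ₀ 2^{−k}`, `δ₀ = (G₀/(c₁ log|B(o,m)|))^{1/4}`, `G₀ = log(4/F₀)`; parameters `p_k = Spr(p; 2δ₀(1 − 2^{−k}))`, all below `p_∞ = Spr(p; 2δ₀)`;
* floors `F_{k+1} = c₂ F_k²` (i.e. `F_k = 4e^{−G_k}`, `G_k = 2^k G₀ + (2^k − 1) log(1/4c₂)`, after shrinking `c₂ ≤ 1/4`);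
* INDUCTION `F_k ≤ κ_{p_k}(3 m_k)` by the one-step lemma «Step» `kappa_step` with station budget `N_k = 3 m_{k+1} + 2`, whose two requirements reduce to
  geometric-series inequalities: the floor `G_k ≤ c₁ δ_k⁴ log|B(o,m_k)| (≥ 4^k G₀)` and the budget `3 m_{k+1} + 1 ≤ c₃ exp(c₁ δ_k³ log|B(o,m_k)|)` (the exponent is
  `≥ 8^k Q₀`, `Q₀ = G₀/δ₀ ≍ (log|B(o,m)|)^{1/4} G₀^{3/4} → ∞`, and the left side is `≲ (log|B(o,m_k)|)^{1/a}`, controlled because `x ↦ θx − a⁻¹ log x` increases);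
* divergence `F_k·|B(o, 3m_k)| ≥ 4 exp(64^k log|B(o,m)|/2) → ∞`, so `χ(p_∞) = ∞` («Defs» `not_summable_of_floor_tower`), `p_c ≤ p_∞` (sharpness,
  `criticalProb_le_of_not_summable`), `δ(p, p_c) ≤ 2δ₀` («Scales» `sprDist_le_of_le_spr`), and the room bound «Defs» `sprDist_ge` gives
  `p_c − p ≤ 2Λ_c δ₀ ≤ 2Λ_c K_δ ((log m + 1)/m^a)^{1/4}`, contradicting the depth hypothesis with `C = 2Λ_c K_δ + 1`.
All "for `m` large" clauses are collected at the start (`exists_log_nat_le_rpow`, `exists_log_le_mul_rpow`); the arithmetic of each step is in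
«SnowballSqueezeTowerLemmas» (`tower_floor`, `tower_budget`, `sprinkle_ladder`, `tower_scales`).
[cite: EasoHutchcroft2023, Prop. 4.1 (15), §4.2 (snowballing across scales); §7.1 p. 139 (p = p_c not treated)] [cite: Hutchcroft2016, §2] [cite: DuminilCopinTassion2016, Thm. 1.1]
-/

noncomputable section

namespace Summit.CriticalPhenomena.PercolationContinuityZ3.Theorems.Transplant

namespace SnowballSqueeze

open SimpleGraph MeasureTheory Filter Literature.Barriers.CriticalPhenomena Literature.Probability.Percolation
  Literature.Probability.Percolation.Snowballing
open scoped Classical Topology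

variable {V : Type}

/-- **N1 ON A GENERIC GRAPH (the snowball squeeze).**  On a connected, vertex-transitive, locally finite graph: the snowballing implication `SnowballStep G d`
(Easo–Hutchcroft Prop. 4.1 (15) in per-graph form — a HYPOTHESIS here), stretched-exponential growth `GrowthLower G o a` (`a > 0`) and `1/d < p_c(o) < 1` imply
`NearCriticalShortLRO G o a 4 c` for every `c > 0`: a polynomial two-point floor `κ_p(3m) ≥ m^{−c}` is impossible at depth `≥ C((log m + 1)/m^a)^{1/4}` below
`p_c`.  (The tower: prescribed sprinkles `δ₀ 2^{−k}`, scales with `log|B|` multiplied by `≥ 64` at each step, floors squared; divergence of `χ` at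
`Spr(p; 2δ₀)`, sharpness, room bound.)  Nothing about `θ(p_c)`. [cite: EasoHutchcroft2023, Prop. 4.1 (15) and §4.2] [cite: DuminilCopinTassion2016, Thm. 1.1] -/
theorem nearCriticalShortLRO_of_snowballStep (G : SimpleGraph V) [G.LocallyFinite] (hconn : G.Connected) (htrans : IsGraphTransitive G)
    {d : ℕ} (hd : 1 ≤ d) (hstep : SnowballStep G d) (o : V) {a : ℝ} (ha : 0 < a) (hgr : GrowthLower G o a)
    (hpc : (1 : ℝ) / d < criticalProb G o) (hpc1 : criticalProb G o < 1) {c : ℝ} (hc : 0 < c) :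
    NearCriticalShortLRO G o a 4 c := by
  haveI : Nonempty V := ⟨o⟩
  haveI : Countable V := countable_of_connected_of_locallyFinite G hconn o
  -- ### constants of the snowballing implication (shrink `c₂` to `≤ 1/4`)
  obtain ⟨c₁, h₀, c₂, c₃, hc₁, hh₀, hc₂, hc₃, H⟩ := hstep
  set c₂' : ℝ := min c₂ (1 / 4) with hc₂'def
  have hc₂' : 0 < c₂' := lt_min hc₂ (by norm_num)
  have hc₂'le : c₂' ≤ 1 / 4 := min_le_right _ _
  have H' : ∀ (n : ℕ) (A : ℕ → Set V) (p₁ p₂ : unitInterval) (h : ℝ),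
      1 ≤ n → (∀ i, 1 ≤ i → i ≤ n → (A i).Finite ∧ (A i).Nonempty) →
      (1 : ℝ) / d ≤ p₁ → (p₁ : ℝ) < p₂ → (p₂ : ℝ) < 1 → sprDist p₁ p₂ ≤ 1 →
      0 < h → h ≤ h₀ → (∀ i, 1 ≤ i → i ≤ n → 1 ≤ h * ((A i).ncard : ℝ)) →
      h ^ (c₁ * sprDist p₁ p₂ ^ (3 : ℝ)) ≤ c₃ / n →
      (∀ i, 1 ≤ i → i + 1 ≤ n → 4 * h ^ (c₁ * sprDist p₁ p₂ ^ (4 : ℝ)) ≤ tauSet G p₁ (A i ∪ A (i + 1)) (A i ∪ A (i + 1))) →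
      c₂' * tauSet G p₁ (A 1) (A 1) * tauSet G p₁ (A n) (A n) ≤ tauSet G p₂ (A 1) (A n) := by
    intro n A p₁ p₂ h h1 h2 h3 h4 h5 h6 h7 h8 h9 h10 h11
    have hmain := H n A p₁ p₂ h h1 h2 h3 h4 h5 h6 h7 h8 h9 h10 h11
    have hle : c₂' * tauSet G p₁ (A 1) (A 1) * tauSet G p₁ (A n) (A n) ≤ c₂ * tauSet G p₁ (A 1) (A 1) * tauSet G p₁ (A n) (A n) :=
      mul_le_mul_of_nonneg_right (mul_le_mul_of_nonneg_right (min_le_left _ _) (tauSet_nonneg G p₁ _ _)) (tauSet_nonneg G p₁ _ _)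
    exact hle.trans hmain
  set K₂ : ℝ := Real.log (1 / (4 * c₂')) with hK₂def
  have hK₂ : 0 ≤ K₂ := Real.log_nonneg (by rw [le_div_iff₀ (by positivity)]; linarith)
  have hexpK₂ : Real.exp (-K₂) = 4 * c₂' := by
    rw [hK₂def, Real.exp_neg, Real.exp_log (by positivity), one_div, inv_inv]
  -- ### growth data
  obtain ⟨cG, hcG, hev⟩ := hgr
  obtain ⟨NG, hNG⟩ := eventually_atTop.1 hev
  have hB1 : ∀ n, (1 : ℝ) ≤ (ballVolume G o n : ℝ) := fun n => by exact_mod_cast one_le_ballVolume G o n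
  have hbgr : ∀ n, NG ≤ n → cG * (n : ℝ) ^ a ≤ Real.log (ballVolume G o n : ℝ) :=
    fun n hn => (Real.le_log_iff_exp_le (by linarith [hB1 n])).2 (hNG n hn)
  -- ### the constants of the statement
  have hd' : (0 : ℝ) < d := by exact_mod_cast hd
  have hdinv : (0 : ℝ) < 1 / d := by positivity
  have hpc0 : 0 < criticalProb G o := hdinv.trans hpc
  set Λc : ℝ := -Real.log (1 - criticalProb G o) with hΛcdef
  have hΛc : 0 < Λc := by rw [hΛcdef, neg_pos]; exact Real.log_neg (by linarith) (by linarith)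
  set Kδ : ℝ := (max (Real.log 4) c / (c₁ * cG)) ^ (1 / 4 : ℝ) with hKδdef
  have hKδ : 0 ≤ Kδ := Real.rpow_nonneg (div_nonneg (le_max_of_le_right hc.le) (by positivity)) _
  set C : ℝ := 2 * Λc * Kδ + 1 with hCdef
  have hC : 0 < C := by positivity
  set K₉ : ℝ := Real.log (3 * NG + 13) + (1 / a) * Real.log (64 / cG) - Real.log c₃ with hK₉def
  set Kc : ℝ := |K₉| + Real.log 64 / a + 1 / a with hKcdef
  have hKc : 0 ≤ Kc := by positivity
  have hlog4 : 1 < Real.log 4 := by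
    have : Real.exp 1 < 4 := lt_trans Real.exp_one_lt_d9 (by norm_num)
    rwa [Real.lt_log_iff_exp_lt (by norm_num)]
  have hmax0 : 0 < max (Real.log 4) c := lt_max_of_lt_right hc
  -- ### thresholds ("m large")
  obtain ⟨M₁, hM₁⟩ := exists_log_nat_le_rpow (max (Real.log 4) c) (c₁ * cG) (by positivity) ha
  obtain ⟨M₂, hM₂⟩ := exists_log_nat_le_rpow (max (Real.log 4) c) (cG / 8) (by positivity) ha
  obtain ⟨Y, hY0, hY⟩ := exists_log_le_mul_rpow (1 / a) Kc (κ := c₁ ^ (1 / 4 : ℝ)) (r := 1 / 4) (by positivity) (by norm_num)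
  obtain ⟨M₃, hM₃⟩ := exists_log_nat_le_rpow (|Real.log h₀| + Y + 1) cG hcG ha
  have hεpos : 0 < (criticalProb G o - 1 / d) / C := div_pos (by linarith) hC
  have hε4 : 0 < ((criticalProb G o - 1 / d) / C) ^ (4 : ℕ) := by positivity
  obtain ⟨M₄, hM₄⟩ := exists_log_nat_le_rpow 1 (((criticalProb G o - 1 / d) / C) ^ (4 : ℕ)) hε4 ha
  set M₅ : ℕ := ⌈Real.exp (K₂ / c)⌉₊ with hM₅def
  refine ⟨C, max (max (max NG 1) (max M₁ M₂)) (max (max M₃ M₄) M₅), ?_⟩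
  intro m p hm hp
  have hmNG : NG ≤ m := le_trans (by omega) hm
  have hm1 : 1 ≤ m := le_trans (by omega) hm
  have hmM₁ : M₁ ≤ m := le_trans (by omega) hm
  have hmM₂ : M₂ ≤ m := le_trans (by omega) hm
  have hmM₃ : M₃ ≤ m := le_trans (by omega) hm
  have hmM₄ : M₄ ≤ m := le_trans (by omega) hm
  have hmM₅ : M₅ ≤ m := le_trans (by omega) hm
  have hmpos : (0 : ℝ) < m := by exact_mod_cast hm1
  have hma : 0 < (m : ℝ) ^ a := Real.rpow_pos_of_pos hmpos a
  have hlogm : 0 ≤ Real.log m := Real.log_nonneg (by exact_mod_cast hm1)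
  -- the depth
  set ε : ℝ := ((Real.log m + 1) / (m : ℝ) ^ a) ^ (1 / 4 : ℝ) with hεdef
  have hε0 : 0 < ε := Real.rpow_pos_of_pos (by positivity) _
  -- (T7) `1/d ≤ p_c − C ε`
  have hT7 : (1 : ℝ) / d ≤ criticalProb G o - C * ε := by
    have h := hM₄ m hmM₄
    rw [one_mul] at h
    have h' : (Real.log m + 1) / (m : ℝ) ^ a ≤ ((criticalProb G o - 1 / d) / C) ^ (4 : ℕ) := by rw [div_le_iff₀ hma]; exact h
    have h'' : ε ≤ (criticalProb G o - 1 / d) / C := by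
      have h4 := Real.rpow_le_rpow (by positivity) h' (by norm_num : (0 : ℝ) ≤ 1 / 4)
      have e4 : ((((criticalProb G o - 1 / d) / C) ^ (4 : ℕ)) ^ (1 / 4 : ℝ)) = (criticalProb G o - 1 / d) / C := by
        rw [show (1 / 4 : ℝ) = ((4 : ℕ) : ℝ)⁻¹ by norm_num]; exact Real.pow_rpow_inv_natCast hεpos.le (by norm_num)
      rw [e4] at h4
      exact h4
    rw [le_div_iff₀ hC] at h''
    linarith
  by_contra hcon
  push Not at hcon
  -- `hcon : m^{-c} ≤ κ_p(3m)`
  -- ### S0: replace `p` by `q = max p (1/d)`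
  set q : ℝ := max (p : ℝ) (1 / d) with hqdef
  have hq_ge : (1 : ℝ) / d ≤ q := le_max_right _ _
  have hq0 : 0 < q := hdinv.trans_le hq_ge
  have hq_le : q ≤ criticalProb G o - C * ε := max_le hp hT7
  have hq_lt_pc : q < criticalProb G o := by have := mul_pos hC hε0; linarith
  have hq1 : q < 1 := hq_lt_pc.trans hpc1
  set qI₀ : unitInterval := ⟨q, hq0.le, hq1.le⟩ with hqI₀def
  have hpq : p ≤ qI₀ := Subtype.coe_le_coe.1 (le_max_left _ _)
  have hqI₀coe : ((qI₀ : unitInterval) : ℝ) = q := rfl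
  set F₀ : ℝ := (m : ℝ) ^ (-c) with hF₀def
  have hF₀pos : 0 < F₀ := Real.rpow_pos_of_pos hmpos _
  have hF₀le : F₀ ≤ 1 := Real.rpow_le_one_of_one_le_of_nonpos (by exact_mod_cast hm1) (by linarith)
  have hfloor₀ : F₀ ≤ kappa G qI₀ (3 * m) := hcon.trans (kappa_mono G hpq _)
  -- ### the base quantities `b₀, G₀, δ₀, Q₀`
  set b₀ : ℝ := Real.log (ballVolume G o m : ℝ) with hb₀def
  have hb₀ge : cG * (m : ℝ) ^ a ≤ b₀ := hbgr m hmNG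
  have hb₀pos : 0 < b₀ := (mul_pos hcG hma).trans_le hb₀ge
  set G₀ : ℝ := Real.log (4 / F₀) with hG₀def
  have hG₀eq : G₀ = Real.log 4 + c * Real.log m := by
    rw [hG₀def, Real.log_div (by norm_num) hF₀pos.ne', hF₀def, Real.log_rpow hmpos]; ring
  have hG₀ge : Real.log 4 ≤ G₀ := by rw [hG₀eq]; linarith only [mul_nonneg hc.le hlogm]
  have hG₀pos : 0 < G₀ := by linarith
  have hG₀le : G₀ ≤ max (Real.log 4) c * (Real.log m + 1) := by
    rw [hG₀eq]
    have h1 := le_max_left (Real.log 4) c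
    have h2 : c * Real.log m ≤ max (Real.log 4) c * Real.log m := mul_le_mul_of_nonneg_right (le_max_right _ _) hlogm
    have e : max (Real.log 4) c * (Real.log m + 1) = max (Real.log 4) c * Real.log m + max (Real.log 4) c := by ring
    linarith only [h1, h2, e]
  have hexpG₀ : Real.exp (-G₀) = F₀ / 4 := by
    rw [hG₀def, Real.exp_neg, Real.exp_log (by positivity), inv_div]
  -- (T3) `G₀ ≤ c₁ b₀`, (T6) `G₀ ≤ b₀ / 8`, (T4) `K₂ ≤ G₀`, (T2)/(T5) via `b₀ ≥ |log h₀| + Y + 1`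
  have hT3 : G₀ ≤ c₁ * b₀ := hG₀le.trans ((hM₁ m hmM₁).trans (by rw [mul_assoc]; exact mul_le_mul_of_nonneg_left hb₀ge hc₁.le))
  have hT6 : G₀ ≤ b₀ / 8 := hG₀le.trans ((hM₂ m hmM₂).trans (by linarith))
  have hT4 : K₂ ≤ G₀ := by
    have h1 : Real.exp (K₂ / c) ≤ m := (Nat.le_ceil _).trans (by exact_mod_cast hmM₅)
    have h2 : K₂ / c ≤ Real.log m := (Real.le_log_iff_exp_le hmpos).2 h1
    rw [div_le_iff₀ hc] at h2
    rw [hG₀eq]; linarith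
  have hb₀big : |Real.log h₀| + Y + 1 ≤ b₀ := by
    have h := hM₃ m hmM₃
    have : (|Real.log h₀| + Y + 1) * 1 ≤ (|Real.log h₀| + Y + 1) * (Real.log m + 1) :=
      mul_le_mul_of_nonneg_left (by linarith) (by positivity)
    linarith
  set δ₀ : ℝ := (G₀ / (c₁ * b₀)) ^ (1 / 4 : ℝ) with hδ₀def
  have hδ₀pos : 0 < δ₀ := Real.rpow_pos_of_pos (by positivity) _
  have hδ₀4 : δ₀ ^ (4 : ℕ) = G₀ / (c₁ * b₀) := by
    rw [hδ₀def, show (1 / 4 : ℝ) = ((4 : ℕ) : ℝ)⁻¹ by norm_num, Real.rpow_inv_natCast_pow (by positivity) (by norm_num)]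
  have hδ₀le1 : δ₀ ≤ 1 := by
    have h : G₀ / (c₁ * b₀) ≤ 1 := by rw [div_le_one (by positivity)]; exact hT3
    calc δ₀ = (G₀ / (c₁ * b₀)) ^ (1 / 4 : ℝ) := rfl
      _ ≤ 1 ^ (1 / 4 : ℝ) := Real.rpow_le_rpow (by positivity) h (by norm_num)
      _ = 1 := Real.one_rpow _
  have hc₁δ₀4 : c₁ * δ₀ ^ (4 : ℕ) = G₀ / b₀ := by rw [hδ₀4]; field_simp
  set Q₀ : ℝ := c₁ * δ₀ ^ (3 : ℕ) * b₀ with hQ₀def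
  have hQ₀eq : Q₀ * δ₀ = G₀ := by
    have : Q₀ * δ₀ = c₁ * δ₀ ^ (4 : ℕ) * b₀ := by rw [hQ₀def]; ring
    rw [this, hc₁δ₀4]; field_simp
  -- `Q₀ ≥ (c₁ b₀)^{1/4} ≥ a⁻¹ log b₀ + Kc`
  have hQ₀ge : c₁ ^ (1 / 4 : ℝ) * b₀ ^ (1 / 4 : ℝ) ≤ Q₀ := by
    -- `δ₀ · (c₁ b₀)^{1/4} = G₀^{1/4} ≤ G₀ = Q₀ δ₀`
    have e1 : δ₀ * (c₁ ^ (1 / 4 : ℝ) * b₀ ^ (1 / 4 : ℝ)) = G₀ ^ (1 / 4 : ℝ) := by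
      rw [← Real.mul_rpow hc₁.le hb₀pos.le, hδ₀def, ← Real.mul_rpow (by positivity) (by positivity),
        div_mul_cancel₀ _ (by positivity)]
    have e2 : G₀ ^ (1 / 4 : ℝ) ≤ G₀ := by
      have := Real.rpow_le_rpow_of_exponent_le (by linarith : (1 : ℝ) ≤ G₀) (by norm_num : (1 / 4 : ℝ) ≤ 1)
      rwa [Real.rpow_one] at this
    have e3 : δ₀ * (c₁ ^ (1 / 4 : ℝ) * b₀ ^ (1 / 4 : ℝ)) ≤ δ₀ * Q₀ := by rw [e1, mul_comm δ₀ Q₀, hQ₀eq]; exact e2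
    exact le_of_mul_le_mul_left e3 hδ₀pos
  have hQ₀Kc : (1 / a) * Real.log b₀ + Kc ≤ Q₀ := (hY b₀ (by linarith [abs_nonneg (Real.log h₀)])).trans hQ₀ge
  have hb₀1 : 1 ≤ b₀ := by linarith [abs_nonneg (Real.log h₀), hY0]
  have hlogb₀ : 0 ≤ Real.log b₀ := Real.log_nonneg hb₀1
  have hQ₀a : 1 ≤ a * Q₀ := by
    have h1 : 1 / a ≤ Q₀ := by
      have : (0:ℝ) ≤ (1 / a) * Real.log b₀ := by positivity
      rw [hKcdef] at hQ₀Kc; linarith [abs_nonneg K₉, div_nonneg (Real.log_nonneg (by norm_num : (1:ℝ) ≤ 64)) ha.le]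
    have := mul_le_mul_of_nonneg_left h1 ha.le
    rwa [mul_one_div_cancel ha.ne'] at this
  have hQ₀64 : Real.log 64 / a ≤ Q₀ := by
    have : (0:ℝ) ≤ (1 / a) * Real.log b₀ := by positivity
    rw [hKcdef] at hQ₀Kc; linarith [abs_nonneg K₉, div_nonneg (zero_le_one) ha.le]
  have hQ₀K₉ : K₉ + (1 / a) * Real.log b₀ ≤ Q₀ := by
    rw [hKcdef] at hQ₀Kc
    linarith [le_abs_self K₉, div_nonneg (Real.log_nonneg (by norm_num : (1:ℝ) ≤ 64)) ha.le, div_nonneg (zero_le_one) ha.le]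
  have hQ₀pos : 0 < Q₀ := by
    by_contra hneg
    push Not at hneg
    have : a * Q₀ ≤ 0 := mul_nonpos_of_nonneg_of_nonpos ha.le hneg
    linarith only [this, hQ₀a]
  -- freeze the constants (their defining equations stay as hypotheses; no further unfolding)
  clear_value Q₀ δ₀ G₀ b₀ F₀ qI₀ q ε M₅ Kc K₉ C Kδ Λc K₂ c₂'
  -- ### the scales
  obtain ⟨ms, hms0, hms_ge, hbk_ge', hms_succ_le⟩ := tower_scales G o hcG ha hNG hm1 hmNG
  obtain ⟨bk, hbk⟩ : ∃ bk : ℕ → ℝ, ∀ k, bk k = Real.log (ballVolume G o (ms k) : ℝ) := ⟨_, fun _ => rfl⟩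
  have hms1 : ∀ k, 1 ≤ ms k := fun k => le_trans hm1 (hms_ge k)
  have hB_k : ∀ k, (0 : ℝ) < (ballVolume G o (ms k) : ℝ) := fun k => by linarith only [hB1 (ms k)]
  have hbk_ge : ∀ k, (64 : ℝ) ^ k * b₀ ≤ bk k := fun k => by rw [hbk, hb₀def]; exact hbk_ge' k
  have hbk_pos : ∀ k, 0 < bk k := fun k => lt_of_lt_of_le (by positivity) (hbk_ge k)
  have hbk_ge0 : ∀ k, b₀ ≤ bk k := fun k => le_trans (by
    have h1 : (1 : ℝ) ≤ 64 ^ k := one_le_pow₀ (by norm_num)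
    have h2 := mul_le_mul_of_nonneg_right h1 hb₀pos.le
    linarith only [h2]) (hbk_ge k)
  -- ### floors and sprinkles
  obtain ⟨Gk, hGk⟩ : ∃ Gk : ℕ → ℝ, ∀ k, Gk k = (2 : ℝ) ^ k * G₀ + ((2 : ℝ) ^ k - 1) * K₂ := ⟨_, fun _ => rfl⟩
  obtain ⟨Fk, hFk⟩ : ∃ Fk : ℕ → ℝ, ∀ k, Fk k = 4 * Real.exp (-Gk k) := ⟨_, fun _ => rfl⟩
  have hFk0 : Fk 0 = F₀ := by rw [hFk, hGk]; simp only [pow_zero, one_mul, sub_self, zero_mul, add_zero]; rw [hexpG₀]; ring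
  have hFk_succ : ∀ k, Fk (k + 1) = c₂' * Fk k ^ 2 := by
    intro k
    rw [hFk, hFk, hGk, hGk]
    have e : -(2 ^ (k + 1) * G₀ + (2 ^ (k + 1) - 1) * K₂) = (-(2 ^ k * G₀ + (2 ^ k - 1) * K₂)) + (-(2 ^ k * G₀ + (2 ^ k - 1) * K₂)) + (-K₂) := by ring
    rw [e, Real.exp_add, Real.exp_add, hexpK₂]
    ring
  have hFk_pos : ∀ k, 0 < Fk k := fun k => by rw [hFk]; positivity
  have hGk_le : ∀ k, Gk k ≤ (2 : ℝ) ^ (k + 1) * G₀ := fun k => by rw [hGk]; exact tower_G_le hK₂ hT4 k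
  obtain ⟨δk, hδk⟩ : ∃ δk : ℕ → ℝ, ∀ k, δk k = δ₀ / (2 : ℝ) ^ k := ⟨_, fun _ => rfl⟩
  have hδk_pos : ∀ k, 0 < δk k := fun k => by rw [hδk]; positivity
  have hδk_le : ∀ k, δk k ≤ δ₀ := fun k => by rw [hδk]; exact div_le_self hδ₀pos.le (one_le_pow₀ (by norm_num))
  have hR3 : ∀ k, Gk k ≤ c₁ * δk k ^ (4 : ℕ) * bk k := fun k => by
    rw [hGk, hδk]; exact tower_floor hG₀pos hb₀pos hK₂ hT4 hc₁δ₀4 k (hbk_ge k)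
  have hQ₀K₉' : Real.log (3 * NG + 13) + (1 / a) * Real.log (64 / cG) - Real.log c₃ + (1 / a) * Real.log b₀ ≤ Q₀ := by
    rw [hK₉def] at hQ₀K₉; exact hQ₀K₉
  have hKEY : ∀ k, (3 * (ms (k + 1) : ℝ) + 1) ≤ c₃ * Real.exp (c₁ * δk k ^ (3 : ℕ) * bk k) := fun k => by
    rw [hδk]
    have h1 := hms_succ_le k
    rw [← hbk] at h1
    exact h1.trans (tower_budget ha hcG hc₃ hc₁ hδ₀pos hb₀pos hQ₀def hQ₀pos hQ₀a hQ₀64 hQ₀K₉' k (hbk_ge k))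
  -- ### the parameters
  obtain ⟨qI, pinfI, hqI0', hpinf, hqI_lt, hqI_lt1, hqI_ge, hqI_dist, hqI_le⟩ := sprinkle_ladder hq0 hq1 hδ₀pos
  have hqI0 : qI 0 = qI₀ := Subtype.ext (by rw [hqI0', hqI₀coe])
  -- ### the induction: floors at every scale
  have hclaim : ∀ k, Fk k ≤ kappa G (qI k) (3 * ms k) := by
    intro k
    induction k with
    | zero => rw [hFk0, hqI0, hms0]; exact hfloor₀
    | succ k ih =>
      have hN : 2 ≤ 3 * ms (k + 1) + 2 := by omega
      have hp₁ : (1 : ℝ) / d ≤ (qI k : ℝ) := hq_ge.trans (hqI_ge k)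
      have hdist : sprDist (qI k : ℝ) (qI (k + 1) : ℝ) = δk k := by rw [hδk]; exact hqI_dist k
      have hδ : sprDist (qI k : ℝ) (qI (k + 1) : ℝ) ≤ 1 := by rw [hdist]; exact (hδk_le k).trans hδ₀le1
      have hh₀ : 1 / (ballVolume G o (ms k) : ℝ) ≤ h₀ := by
        have h1 : Real.log (1 / h₀) ≤ bk k := by
          rw [Real.log_div one_ne_zero hh₀.ne', Real.log_one, zero_sub]
          exact (neg_le_abs _).trans (by linarith only [hbk_ge0 k, hb₀big, hY0])
        have h2 : 1 / h₀ ≤ (ballVolume G o (ms k) : ℝ) := by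
          have h3 := Real.exp_le_exp.2 h1
          rwa [Real.exp_log (by positivity), hbk, Real.exp_log (hB_k k)] at h3
        rw [div_le_iff₀ (hB_k k)]
        rw [div_le_iff₀ hh₀] at h2
        linarith only [h2]
      have hfl : 4 * (1 / (ballVolume G o (ms k) : ℝ)) ^ (c₁ * sprDist (qI k : ℝ) (qI (k + 1) : ℝ) ^ (4 : ℝ)) ≤ Fk k := by
        rw [hdist, show (4 : ℝ) = ((4 : ℕ) : ℝ) by norm_num, Real.rpow_natCast, one_div_rpow_eq_exp (hB_k k), ← hbk, hFk, Nat.cast_ofNat]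
        exact mul_le_mul_of_nonneg_left (Real.exp_le_exp.2 (neg_le_neg (hR3 k))) (by norm_num)
      have hbud : (1 / (ballVolume G o (ms k) : ℝ)) ^ (c₁ * sprDist (qI k : ℝ) (qI (k + 1) : ℝ) ^ (3 : ℝ)) ≤
          c₃ / ((3 * ms (k + 1) + 2 - 1 : ℕ) : ℝ) := by
        rw [hdist, show (3 : ℝ) = ((3 : ℕ) : ℝ) by norm_num, Real.rpow_natCast, one_div_rpow_eq_exp (hB_k k), ← hbk]
        have e : ((3 * ms (k + 1) + 2 - 1 : ℕ) : ℝ) = 3 * (ms (k + 1) : ℝ) + 1 := by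
          rw [show 3 * ms (k + 1) + 2 - 1 = 3 * ms (k + 1) + 1 by omega]; push_cast; ring
        rw [e, le_div_iff₀ (by positivity), Real.exp_neg]
        have hK := hKEY k
        calc (Real.exp (c₁ * δk k ^ 3 * bk k))⁻¹ * (3 * (ms (k + 1) : ℝ) + 1)
            ≤ (Real.exp (c₁ * δk k ^ 3 * bk k))⁻¹ * (c₃ * Real.exp (c₁ * δk k ^ 3 * bk k)) :=
              mul_le_mul_of_nonneg_left hK (by positivity)
          _ = c₃ := by field_simp
      have hstep := kappa_step G htrans o hc₂' H' (m := ms k) (N := 3 * ms (k + 1) + 2) hN hp₁ (hqI_lt k) (hqI_lt1 (k + 1)) hδ hh₀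
        (hFk_pos k).le ih hfl hbud
      rw [← hFk_succ] at hstep
      refine hstep.trans (kappa_anti G _ ?_)
      rw [show 3 * ms (k + 1) + 2 - 2 = 3 * ms (k + 1) by omega]
      exact Nat.le_mul_of_pos_right _ (hms1 k)
  -- ### divergence at `p_∞`
  have hflinf : ∀ k, Fk k ≤ kappa G pinfI (3 * ms k) := fun k => (hclaim k).trans (kappa_mono G (hqI_le k) _)
  have hdiv : Tendsto (fun k => Fk k * (ballVolume G o (3 * ms k) : ℝ)) atTop atTop := by
    have hlow : ∀ k : ℕ, 4 * Real.exp (b₀ / 2 * (k : ℝ)) ≤ Fk k * (ballVolume G o (3 * ms k) : ℝ) := by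
      intro k
      have h1 : (ballVolume G o (ms k) : ℝ) ≤ (ballVolume G o (3 * ms k) : ℝ) := by exact_mod_cast Milnor.ballVolume_mono G o (by omega)
      have h2 : (ballVolume G o (ms k) : ℝ) = Real.exp (bk k) := by rw [hbk, Real.exp_log (hB_k k)]
      have h3 : Gk k ≤ bk k / 2 := by
        have h22 : (2 : ℝ) ^ k ≤ 64 ^ k := pow_le_pow_left₀ (by norm_num : (0 : ℝ) ≤ 2) (by norm_num : (2 : ℝ) ≤ 64) k
        have h23 := mul_le_mul_of_nonneg_right h22 hb₀pos.le
        calc Gk k ≤ 2 ^ (k + 1) * G₀ := hGk_le k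
          _ ≤ 2 ^ (k + 1) * (b₀ / 8) := mul_le_mul_of_nonneg_left hT6 (by positivity)
          _ = 2 ^ k * b₀ / 4 := by rw [pow_succ]; ring
          _ ≤ 64 ^ k * b₀ / 4 := by linarith only [h23]
          _ ≤ bk k / 4 := by linarith only [hbk_ge k]
          _ ≤ bk k / 2 := by linarith only [hbk_pos k]
      have h4 : b₀ / 2 * (k : ℝ) ≤ bk k - Gk k := by
        have h64 : (k : ℝ) * b₀ ≤ 64 ^ k * b₀ := mul_le_mul_of_nonneg_right (by linarith only [one_add_le_sixtyfour_pow k]) hb₀pos.le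
        have e : b₀ / 2 * (k : ℝ) = (k * b₀) / 2 := by ring
        linarith only [hbk_ge k, h3, h64, e]
      calc 4 * Real.exp (b₀ / 2 * (k : ℝ)) ≤ 4 * Real.exp (bk k - Gk k) := mul_le_mul_of_nonneg_left (Real.exp_le_exp.2 h4) (by norm_num)
        _ = Fk k * Real.exp (bk k) := by rw [hFk, mul_assoc, ← Real.exp_add]; ring_nf
        _ ≤ Fk k * (ballVolume G o (3 * ms k) : ℝ) := by rw [← h2]; exact mul_le_mul_of_nonneg_left h1 (hFk_pos k).le
    refine tendsto_atTop_mono hlow ?_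
    refine Tendsto.const_mul_atTop (by norm_num) (Real.tendsto_exp_atTop.comp ?_)
    exact tendsto_natCast_atTop_atTop.const_mul_atTop (by positivity)
  have hns : ¬ Summable (fun x => (bondPercolation G pinfI).real (openConn o x)) := not_summable_of_floor_tower G pinfI o hflinf hdiv
  have hpc_le : criticalProb G o ≤ spr q (2 * δ₀) := by
    rw [← hpinf]; exact criticalProb_le_of_not_summable G hconn htrans.isQuasiTransitive o pinfI hns
  -- ### the room bound: contradiction
  have hdist_pc : sprDist q (criticalProb G o) ≤ 2 * δ₀ := sprDist_le_of_le_spr hq0 hq1 hpc1 hq_lt_pc.le hpc_le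
  have hroom := sprDist_ge hq0 hq_lt_pc hpc1
  have h1q : 0 < 1 - q := by linarith only [hq1]
  have hgap : criticalProb G o - q ≤ 2 * Λc * δ₀ := by
    have h := hroom.trans hdist_pc
    rw [← hΛcdef, div_le_iff₀ (mul_pos h1q hΛc)] at h
    have h2 : 2 * δ₀ * ((1 - q) * Λc) ≤ 2 * δ₀ * (1 * Λc) := by
      apply mul_le_mul_of_nonneg_left _ (by positivity)
      exact mul_le_mul_of_nonneg_right (by linarith only [hq0]) hΛc.le
    linarith only [h, h2]
  -- `δ₀ ≤ Kδ ε`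
  have hδ₀ε : δ₀ ≤ Kδ * ε := by
    rw [hδ₀def, hKδdef, hεdef]
    have h1 : G₀ / (c₁ * b₀) ≤ (max (Real.log 4) c / (c₁ * cG)) * ((Real.log m + 1) / (m : ℝ) ^ a) := by
      rw [div_mul_div_comm]
      exact div_le_div₀ (by positivity) hG₀le (by positivity) (by rw [mul_assoc]; exact mul_le_mul_of_nonneg_left hb₀ge hc₁.le)
    have h2 := Real.rpow_le_rpow (by positivity) h1 (by norm_num : (0 : ℝ) ≤ 1 / 4)
    rw [Real.mul_rpow (by positivity) (by positivity)] at h2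
    exact h2
  have hgap' : criticalProb G o - q ≤ 2 * Λc * Kδ * ε := by
    have h := mul_le_mul_of_nonneg_left hδ₀ε (by positivity : (0 : ℝ) ≤ 2 * Λc)
    have e : 2 * Λc * (Kδ * ε) = 2 * Λc * Kδ * ε := by ring
    linarith only [hgap, h, e]
  have hge : C * ε ≤ criticalProb G o - q := by linarith only [hq_le]
  rw [hCdef] at hge
  have e : (2 * Λc * Kδ + 1) * ε = 2 * Λc * Kδ * ε + ε := by ring
  linarith only [hge, hgap', hε0, e]

end SnowballSqueeze

end Summit.CriticalPhenomena.PercolationContinuityZ3.Theorems.Transplant
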